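import Mathlib
import HarnessLib
import Literature.NumberTheory.LFunctions.CriticalLineTwoThirds
import Literature.NumberTheory.LFunctions.CriticalLineTwoThirdsInertia
import Literature.NumberTheory.LFunctions.DirichletPolynomialMeanValueHilbertProofs

/-!
# RH-FREE — «nothing here bears on the truth of RH»: Alpöge–Furman 2026 (arXiv:2608.13637), the two
# remaining finite-dimensional inputs PROVED — Lemma 2.2 (Montgomery–Vaughan, bilinear form) with
# the spacing remark (2.9), and Lemma 3.3 (Weyl)

Topic `Literature/NumberTheory/LFunctions` (namespace `Literature.NumberTheory.LFunctions`; helper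
lemmas in the sub-namespace `AlpogeFurman2026.Spectral`). PROOF LAYER (theorems only: no
definition, no named fact, net debt 0) next to the statement file `CriticalLineTwoThirds.lean`
(cell `rh-columns/lit`, RH literature-typing tranche 1, unit `rh-lit-frontier-1` gen 3) and the
proof files `CriticalLineTwoThirdsProofs.lean` (Lemma 3.2 rank–trace, Lemma 5.6 window constants)
and `CriticalLineTwoThirdsInertia.lean` (Lemma 3.1 inertia under pull-back, both directions of
Sylvester's law for `n₊`). With this file every lemma of [AF26] §§2.3–3 that is a statement of
finite-dimensional linear algebra is a kernel theorem of this tree; the analytic inputs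
(Lemma 2.1 Poisson–Gabor, Propositions 4.1–4.3, 5.2–5.5, Theorem 5.7) and the main theorems are
not touched (D-0040) and remain the claims of `CriticalLineTwoThirds.lean`.

## What the source prints (TeX v2 of record, `rh-crit/ah/src/AlpogeFurman2026_arXiv2608.13637v2.tex`)

L. Alpöge, R. Furman, *More than two thirds of the zeros of the Riemann zeta function are simple
and on the critical line*, arXiv:2608.13637v2 (2026), UNREFEREED (D-0012) [key `AlpogeFurman2026`]:

* **Lemma 2.2** [Montgomery–Vaughan, bilinear form] (§2.3, p. 4; TeX l. 250–259). "Let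
  `λ_1, …, λ_R ∈ ℝ` be distinct, `δ_r := min_{s ≠ r} |λ_r − λ_s|`, and `x_r, z_r ∈ ℂ`. Then
  `|Σ_{r ≠ s} x_r z̄_s/(λ_r − λ_s)| ≤ (3π/2) (Σ_r |x_r|²/δ_r)^{1/2} (Σ_r |z_r|²/δ_r)^{1/2}`.
  Proof. For `z = x` this is the weighted Hilbert inequality of [MV74, Theorem 2]; … In general,
  with `H_{rs} := i/(λ_r − λ_s)` (`r ≠ s`), `H_{rr} = 0`, and `Δ := diag(δ_r^{1/2})`, the case
  `z = x` says `‖ΔHΔ‖ ≤ 3π/2` (operator norm, `ΔHΔ` Hermitian); then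
  `|x^*Hz| ≤ (3π/2) ‖Δ⁻¹x‖ ‖Δ⁻¹z‖`."
* **(2.9)** (p. 4; TeX l. 261–264). "We apply Lemma 2.2 with `{λ_r} = {log n : n ≤ X prime power}`;
  consecutive prime powers satisfy `log(n′/n) ≥ 1/(2n)`, so `δ_n⁻¹ ≤ 2n`,
  `Σ_n δ_n⁻¹|x_n|² ≤ 2 Σ_n n|x_n|²`."
* **Lemma 3.3** [Weyl] (§3, p. 5; TeX l. 297–302). "If `A, E` are Hermitian with `‖E‖ ≤ θ`, then
  `n₊(A) ≥ #{i : λ_i(A + E) > θ}`. Proof. `λ_i(A + E) ≤ λ_i(A) + ‖E‖` (Courant–Fischer)."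
  (§1.7: `n₊(R)` = number of strictly positive eigenvalues; the statement file's
  `posEigenvalueCount`.)

## What is proved here (tree vocabulary; `n₊ = posEigenvalueCount` of `CriticalLineTwoThirds.lean`)

* §1 `AlpogeFurman2026.Spectral.norm_bilin_le_of_eigenvalues` — the bilinear spectral bound
  `|wᴴ A u| ≤ C ‖w‖ ‖u‖` for a Hermitian matrix whose eigenvalues have modulus `≤ C` (the step
  "`‖ΔHΔ‖ ≤ 3π/2` … then `|x^*Hz| ≤ …`" of the printed proof; the tree's
  `MontgomeryVaughan.norm_form_le_of_eigenvalues` is the case `w = u`).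
* §2 **Lemma 2.2 PROVED**: `AlpogeFurman2026_MV_bilinear_of_sep` (any separation function
  `0 < δ_r ≤ |λ_r − λ_s|`, any finite index type) and `AlpogeFurman2026_MV_bilinear` (AS PRINTED:
  `δ_r = min_{s ≠ r} |λ_r − λ_s|`, binders of the tree's named fact
  `montgomeryVaughan_hilbertInequality` = Ivić (5.34), whose discharge
  `montgomeryVaughan_hilbertInequality_holds` supplies the eigenvalue bound
  `MontgomeryVaughan.abs_eigenvalue_le`); at `z = x` it is that fact verbatim (`√S·√S = S`; not
  restated — `dedup.landed` against `montgomeryVaughan_hilbertInequality_holds`).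
* §3 **(2.9) PROVED** for any family of distinct positive integers (prime powers are a special
  case): `AlpogeFurman2026.Spectral.inv_two_mul_le_abs_log_sub_log`
  (`1/(2n) ≤ |log n − log n′|`, `n ≠ n′ ≥ 1`), and the assembled Dirichlet-polynomial form
  `AlpogeFurman2026_MV_bilinear_log`:
  `|Σ_{r ≠ s} x_r z̄_s/(log n_r − log n_s)| ≤ 3π (Σ_r n_r|x_r|²)^{1/2} (Σ_r n_r|z_r|²)^{1/2}`.
* §4 **Lemma 3.3 PROVED**: `AlpogeFurman2026.Spectral.exists_subspace_form_gt` (a subspace of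
  dimension `#{i : λ_i(B) > θ}` on which `xᴴ B x > θ‖x‖²`: the span of the corresponding
  eigenvectors), `AlpogeFurman2026_weyl` (hypothesis in the form the proof uses:
  `Re xᴴ E x ≤ θ ‖x‖²` for all `x`) and `AlpogeFurman2026_weyl_opNorm` (AS PRINTED: `‖E‖ ≤ θ` in
  Mathlib's `L²`-operator norm on `Matrix n n ℂ`, `open scoped Matrix.Norms.L2Operator`), both via
  the tree's `AlpogeFurman2026.Inertia.finrank_le_posEigenvalueCount` (Sylvester, upper bound).

LABEL: RH-FREE literature (finite-dimensional linear algebra and an elementary logarithm bound; a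
kernel proof verifies, asserts nothing on authority). The source is an unrefereed preprint
(`[claim: AlpogeFurman2026, status: under-review]` in the statement file); nothing here bears on
its analytic claims, on Theorem A/B, or on the truth of RH.

## References

* [AF26] L. Alpöge, R. Furman, arXiv:2608.13637v2 (2026), Lemma 2.2 and (2.9) (§2.3, p. 4),
  Lemma 3.3 (§3, p. 5). [key `AlpogeFurman2026`]
* [MV74] H. L. Montgomery, R. C. Vaughan, *Hilbert's inequality*, J. London Math. Soc. (2) 8
  (1974) 73–82, Theorem 2 [key `MontgomeryVaughan1974`]; A. Ivić, *The Riemann zeta-function*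
  (1985), (5.34) [key `Ivic1985`] (tree: `montgomeryVaughan_hilbertInequality`,
  `DirichletPolynomialMeanValue.lean` / `…HilbertProofs.lean`).
-/

noncomputable section

open Matrix Complex Finset Module
open scoped Real ComplexOrder InnerProductSpace ComplexConjugate Matrix.Norms.L2Operator

namespace Literature.NumberTheory.LFunctions

namespace AlpogeFurman2026.Spectral

variable {n : Type*} [Fintype n] [DecidableEq n]

/-! ## §1. The bilinear spectral bound `|wᴴ A u| ≤ C ‖w‖ ‖u‖` -/

/-- The matrix form `wᴴ A u` is the inner product `⟪w, A u⟫` of `EuclideanSpace ℂ n`. [folklore] -/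
private theorem inner_toEuclideanLin_eq_dotProduct (A : Matrix n n ℂ) (w u : n → ℂ) :
    ⟪(WithLp.toLp 2 w : EuclideanSpace ℂ n),
        Matrix.toEuclideanLin A (WithLp.toLp 2 u : EuclideanSpace ℂ n)⟫_ℂ =
      star w ⬝ᵥ (A *ᵥ u) := by
  rw [EuclideanSpace.inner_eq_star_dotProduct]
  simp only [Matrix.toLpLin_apply, WithLp.ofLp_toLp]
  rw [dotProduct_comm]

/-- **Hermitian bilinear forms are bounded by the spectral radius**: if every eigenvalue of the
Hermitian matrix `A` has modulus `≤ C`, then `|wᴴ A u| ≤ C (Σ|w_i|²)^{1/2} (Σ|u_i|²)^{1/2}` — the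
polarised form of `MontgomeryVaughan.norm_form_le_of_eigenvalues` (expand `u`, `w` in Mathlib's
orthonormal eigenvector basis, `⟪w, Au⟫ = Σ_i λ_i ⟪w, b_i⟫⟪b_i, u⟫`, then Cauchy–Schwarz). This is
the step "`‖ΔHΔ‖ ≤ 3π/2` (operator norm, `ΔHΔ` Hermitian); then `|x^*Hz| ≤ (3π/2)‖Δ⁻¹x‖‖Δ⁻¹z‖`"
of the printed proof. [cite: AlpogeFurman2026, Lemma 2.2, proof (p. 4)] -/
theorem norm_bilin_le_of_eigenvalues {A : Matrix n n ℂ} (hA : A.IsHermitian) {C : ℝ}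
    (hC : ∀ i, |hA.eigenvalues i| ≤ C) (w u : n → ℂ) :
    ‖star w ⬝ᵥ (A *ᵥ u)‖ ≤ C * Real.sqrt (∑ i, ‖w i‖ ^ 2) * Real.sqrt (∑ i, ‖u i‖ ^ 2) := by
  rcases isEmpty_or_nonempty n with hn | hn
  · simp [dotProduct]
  obtain ⟨i₀⟩ := hn
  have hC0 : 0 ≤ C := (abs_nonneg _).trans (hC i₀)
  set U : EuclideanSpace ℂ n := WithLp.toLp 2 u with hU
  set W : EuclideanSpace ℂ n := WithLp.toLp 2 w with hW
  set T := Matrix.toEuclideanLin A with hT_def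
  have hT : T.IsSymmetric := Matrix.isSymmetric_toEuclideanLin_iff.mpr hA
  set b := hA.eigenvectorBasis with hb
  have hTb : ∀ i, T (b i) = (hA.eigenvalues i : ℂ) • b i := by
    intro i
    simp only [hT_def, Matrix.toLpLin_apply]
    have h := hA.mulVec_eigenvectorBasis i
    rw [← hb] at h
    rw [show (b i).ofLp = ⇑(b i) from rfl, h, RCLike.real_smul_eq_coe_smul (K := ℂ)]
    rfl
  have hrepr : ∀ i, ⟪b i, T U⟫_ℂ = (hA.eigenvalues i : ℂ) * ⟪b i, U⟫_ℂ := by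
    intro i
    rw [← hT (b i) U, hTb i, inner_smul_left, Complex.conj_ofReal]
  have hform : ⟪W, T U⟫_ℂ = ∑ i, ⟪W, b i⟫_ℂ * ((hA.eigenvalues i : ℂ) * ⟪b i, U⟫_ℂ) := by
    rw [← b.sum_inner_mul_inner W (T U)]
    exact Finset.sum_congr rfl fun i _ ↦ by rw [hrepr i]
  have hinner : ⟪W, T U⟫_ℂ = star w ⬝ᵥ (A *ᵥ u) := inner_toEuclideanLin_eq_dotProduct A w u
  have hnormsq : ∀ X : EuclideanSpace ℂ n, ∑ i, ‖⟪b i, X⟫_ℂ‖ ^ 2 = ‖X‖ ^ 2 := by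
    intro X
    rw [← b.repr.norm_map X, EuclideanSpace.norm_sq_eq]
    simp only [OrthonormalBasis.repr_apply_apply]
  have hnW : ‖W‖ = Real.sqrt (∑ i, ‖w i‖ ^ 2) := by
    rw [EuclideanSpace.norm_eq]
  have hnU : ‖U‖ = Real.sqrt (∑ i, ‖u i‖ ^ 2) := by
    rw [EuclideanSpace.norm_eq]
  calc ‖star w ⬝ᵥ (A *ᵥ u)‖ = ‖∑ i, ⟪W, b i⟫_ℂ * ((hA.eigenvalues i : ℂ) * ⟪b i, U⟫_ℂ)‖ := by
        rw [← hinner, hform]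
    _ ≤ ∑ i, ‖⟪W, b i⟫_ℂ‖ * (|hA.eigenvalues i| * ‖⟪b i, U⟫_ℂ‖) := by
        refine (norm_sum_le _ _).trans (Finset.sum_le_sum fun i _ ↦ le_of_eq ?_)
        rw [norm_mul, norm_mul, Complex.norm_real, Real.norm_eq_abs]
    _ ≤ ∑ i, C * (‖⟪b i, W⟫_ℂ‖ * ‖⟪b i, U⟫_ℂ‖) := by
        refine Finset.sum_le_sum fun i _ ↦ ?_
        rw [norm_inner_symm]
        calc ‖⟪b i, W⟫_ℂ‖ * (|hA.eigenvalues i| * ‖⟪b i, U⟫_ℂ‖)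
            = |hA.eigenvalues i| * (‖⟪b i, W⟫_ℂ‖ * ‖⟪b i, U⟫_ℂ‖) := by ring
          _ ≤ C * (‖⟪b i, W⟫_ℂ‖ * ‖⟪b i, U⟫_ℂ‖) :=
            mul_le_mul_of_nonneg_right (hC i) (by positivity)
    _ = C * ∑ i, ‖⟪b i, W⟫_ℂ‖ * ‖⟪b i, U⟫_ℂ‖ := by rw [← Finset.mul_sum]
    _ ≤ C * (Real.sqrt (∑ i, ‖⟪b i, W⟫_ℂ‖ ^ 2) * Real.sqrt (∑ i, ‖⟪b i, U⟫_ℂ‖ ^ 2)) :=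
        mul_le_mul_of_nonneg_left (Real.sum_mul_le_sqrt_mul_sqrt _ _ _) hC0
    _ = C * Real.sqrt (∑ i, ‖w i‖ ^ 2) * Real.sqrt (∑ i, ‖u i‖ ^ 2) := by
        rw [hnormsq W, hnormsq U, Real.sqrt_sq (norm_nonneg _), Real.sqrt_sq (norm_nonneg _),
          hnW, hnU, mul_assoc]

end AlpogeFurman2026.Spectral

/-! ## §2. [AF26] Lemma 2.2 — the Montgomery–Vaughan bilinear form inequality -/

open AlpogeFurman2026.Spectral MontgomeryVaughan in
/-- **[AF26] Lemma 2.2 (Montgomery–Vaughan, bilinear form), separation-function form.** For reals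
`λ_r` indexed by a finite type, any `δ_r > 0` with `δ_r ≤ |λ_r − λ_s|` for all `s ≠ r`, and complex
`x_r, z_r`:
`|Σ_{r ≠ s} x_r z̄_s/(λ_r − λ_s)| ≤ (3π/2) (Σ_r |x_r|²/δ_r)^{1/2} (Σ_r |z_r|²/δ_r)^{1/2}`.
Proof as printed: with `K_{rs} = δ_r^{1/2}δ_s^{1/2}/(λ_r − λ_s)`, `A = iK` is Hermitian with all
eigenvalues in `[−3π/2, 3π/2]` (tree: `MontgomeryVaughan.abs_eigenvalue_le`, the eigenvector
computation behind `montgomeryVaughan_hilbertInequality_holds`), and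
`Σ_{r≠s} x_r z̄_s/(λ_r − λ_s) = −i · wᴴ A u` for `w_r = conj(x_r)/δ_r^{1/2}`, `u_s = z̄_s/δ_s^{1/2}`;
apply `norm_bilin_le_of_eigenvalues`. [cite: AlpogeFurman2026, Lemma 2.2 (p. 4)] -/
theorem AlpogeFurman2026_MV_bilinear_of_sep {ι : Type*} [Fintype ι] [DecidableEq ι]
    (lam δ : ι → ℝ) (hδ : ∀ r, 0 < δ r) (hsep : ∀ r s, r ≠ s → δ r ≤ |lam r - lam s|)
    (x z : ι → ℂ) :
    ‖∑ r, ∑ s ∈ univ.erase r, x r * conj (z s) / ((lam r - lam s : ℝ) : ℂ)‖ ≤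
      3 / 2 * π * Real.sqrt (∑ r, ‖x r‖ ^ 2 / δ r) * Real.sqrt (∑ r, ‖z r‖ ^ 2 / δ r) := by
  -- kernel, Hermitian matrix, eigenvalue bound (as in `montgomeryVaughan_hilbertInequality_holds`)
  set c : ι → ℝ := fun r ↦ Real.sqrt (δ r) with hc_def
  have hc0 : ∀ r, 0 < c r := fun r ↦ Real.sqrt_pos.mpr (hδ r)
  set K : ι → ι → ℝ := fun r s ↦ c r * c s / (lam r - lam s) with hK_def
  have hanti : ∀ r s, K s r = -K r s := by
    intro r s
    simp only [hK_def]
    rw [show lam s - lam r = -(lam r - lam s) by ring, div_neg]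
    ring
  set A : Matrix ι ι ℂ := Matrix.of fun r s ↦ I * (K r s : ℂ) with hA_def
  have hAK : ∀ r s, A r s = I * (K r s : ℂ) := fun r s ↦ rfl
  have hA : A.IsHermitian := by
    refine Matrix.IsHermitian.ext fun r s ↦ ?_
    rw [hAK, hAK, hanti r s]
    push_cast
    simp only [star_mul', star_neg, Complex.star_def, Complex.conj_ofReal, Complex.conj_I]
    ring
  have heigs : ∀ i, |hA.eigenvalues i| ≤ 3 * π / 2 := fun i ↦
    abs_eigenvalue_le hδ hsep (fun r ↦ rfl) (fun r s ↦ rfl) hAK hA i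
  -- the two vectors
  set w : ι → ℂ := fun r ↦ conj (x r / (c r : ℂ)) with hw_def
  set u : ι → ℂ := fun s ↦ conj (z s / (c s : ℂ)) with hu_def
  have hbil := norm_bilin_le_of_eigenvalues hA heigs w u
  -- identify `wᴴ A u` with `i ·` the bilinear form of the statement
  have hterm : ∀ r s, star (w r) * (A r s * u s) =
      I * (x r * conj (z s) / ((lam r - lam s : ℝ) : ℂ)) := by
    intro r s
    simp only [hw_def, hu_def, hAK, hK_def, Complex.star_def, map_div₀, Complex.conj_conj,
      Complex.conj_ofReal]
    have hcr : (c r : ℂ) ≠ 0 := by exact_mod_cast (hc0 r).ne'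
    have hcs : (c s : ℂ) ≠ 0 := by exact_mod_cast (hc0 s).ne'
    by_cases hL : lam r - lam s = 0
    · rw [hL]; simp
    · have hL' : ((lam r - lam s : ℝ) : ℂ) ≠ 0 := by exact_mod_cast hL
      push_cast
      field_simp
  have hS : star w ⬝ᵥ (A *ᵥ u) =
      I * ∑ r, ∑ s ∈ univ.erase r, x r * conj (z s) / ((lam r - lam s : ℝ) : ℂ) := by
    calc star w ⬝ᵥ (A *ᵥ u) = ∑ r, ∑ s, star (w r) * (A r s * u s) := by
          simp only [dotProduct, Matrix.mulVec, Pi.star_apply, Finset.mul_sum]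
      _ = ∑ r, ∑ s, I * (x r * conj (z s) / ((lam r - lam s : ℝ) : ℂ)) :=
          Finset.sum_congr rfl fun r _ ↦ Finset.sum_congr rfl fun s _ ↦ hterm r s
      _ = I * ∑ r, ∑ s, x r * conj (z s) / ((lam r - lam s : ℝ) : ℂ) := by
          rw [Finset.mul_sum]
          exact Finset.sum_congr rfl fun r _ ↦ by rw [Finset.mul_sum]
      _ = I * ∑ r, ∑ s ∈ univ.erase r, x r * conj (z s) / ((lam r - lam s : ℝ) : ℂ) := by
          congr 1
          refine Finset.sum_congr rfl fun r _ ↦ ?_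
          exact (Finset.sum_erase (f := fun s ↦ x r * conj (z s) / ((lam r - lam s : ℝ) : ℂ))
            univ (by simp)).symm
  have hnorm : ∀ (y : ι → ℂ), ∑ r, ‖conj (y r / (c r : ℂ))‖ ^ 2 = ∑ r, ‖y r‖ ^ 2 / δ r := by
    intro y
    refine Finset.sum_congr rfl fun r _ ↦ ?_
    simp only [Complex.norm_conj, norm_div, Complex.norm_real, Real.norm_of_nonneg (hc0 r).le,
      div_pow]
    rw [hc_def]
    simp only [Real.sq_sqrt (hδ r).le]
  have hI : ‖star w ⬝ᵥ (A *ᵥ u)‖ =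
      ‖∑ r, ∑ s ∈ univ.erase r, x r * conj (z s) / ((lam r - lam s : ℝ) : ℂ)‖ := by
    rw [hS, norm_mul, Complex.norm_I, one_mul]
  calc ‖∑ r, ∑ s ∈ univ.erase r, x r * conj (z s) / ((lam r - lam s : ℝ) : ℂ)‖
      = ‖star w ⬝ᵥ (A *ᵥ u)‖ := hI.symm
    _ ≤ 3 * π / 2 * Real.sqrt (∑ r, ‖w r‖ ^ 2) * Real.sqrt (∑ r, ‖u r‖ ^ 2) := hbil
    _ = 3 / 2 * π * Real.sqrt (∑ r, ‖x r‖ ^ 2 / δ r) * Real.sqrt (∑ r, ‖z r‖ ^ 2 / δ r) := by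
        rw [show (∑ r, ‖w r‖ ^ 2) = ∑ r, ‖x r‖ ^ 2 / δ r from hnorm x,
          show (∑ r, ‖u r‖ ^ 2) = ∑ r, ‖z r‖ ^ 2 / δ r from hnorm z]
        ring

/-- **[AF26] Lemma 2.2 (Montgomery–Vaughan, bilinear form), AS PRINTED.** "Let `λ_1, …, λ_R ∈ ℝ` be
distinct, `δ_r := min_{s ≠ r} |λ_r − λ_s|`, and `x_r, z_r ∈ ℂ`. Then
`|Σ_{r ≠ s} x_r z̄_s/(λ_r − λ_s)| ≤ (3π/2) (Σ_r |x_r|²/δ_r)^{1/2} (Σ_r |z_r|²/δ_r)^{1/2}`."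
Binders as in the tree's named fact `montgomeryVaughan_hilbertInequality` (Ivić (5.34): `R ≥ 2`
so that `δ_r = ⨅_{s ≠ r} |λ_r − λ_s|` ranges over a nonempty set; distinctness = injectivity of
`λ`). The case `z = x` is that fact (`montgomeryVaughan_hilbertInequality_holds`, since `√S·√S = S`).
[cite: AlpogeFurman2026, Lemma 2.2 (p. 4)] -/
theorem AlpogeFurman2026_MV_bilinear (R : ℕ) (lam : Fin R → ℝ) (x z : Fin R → ℂ) (hR : 2 ≤ R)
    (hinj : Function.Injective lam) :
    ‖∑ r, ∑ s ∈ univ.erase r, x r * conj (z s) / ((lam r - lam s : ℝ) : ℂ)‖ ≤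
      3 / 2 * π * Real.sqrt (∑ r, ‖x r‖ ^ 2 / ⨅ s : {s : Fin R // s ≠ r}, |lam r - lam s|) *
        Real.sqrt (∑ r, ‖z r‖ ^ 2 / ⨅ s : {s : Fin R // s ≠ r}, |lam r - lam s|) := by
  -- the spacing function `δ` and its two properties (as in `montgomeryVaughan_hilbertInequality_holds`)
  have hne : ∀ r : Fin R, Nonempty {s : Fin R // s ≠ r} := by
    intro r
    by_cases h : (r : ℕ) = 0
    · exact ⟨⟨⟨1, by omega⟩, fun e ↦ by simp [Fin.ext_iff, h] at e⟩⟩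
    · exact ⟨⟨⟨0, by omega⟩, fun e ↦ h (by rw [← e])⟩⟩
  set δ : Fin R → ℝ := fun r ↦ ⨅ s : {s : Fin R // s ≠ r}, |lam r - lam s| with hδ_def
  have hδpos : ∀ r, 0 < δ r := by
    intro r
    haveI := hne r
    obtain ⟨s, hs⟩ :=
      exists_eq_ciInf_of_finite (f := fun s : {s : Fin R // s ≠ r} ↦ |lam r - lam s|)
    show 0 < ⨅ s : {s : Fin R // s ≠ r}, |lam r - lam s|
    rw [← hs]
    exact abs_pos.mpr (sub_ne_zero.mpr fun h ↦ s.2 (hinj h).symm)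
  have hsep : ∀ r s, r ≠ s → δ r ≤ |lam r - lam s| := by
    intro r s hrs
    exact ciInf_le (Set.finite_range fun s : {s : Fin R // s ≠ r} ↦ |lam r - lam s|).bddBelow
      (⟨s, Ne.symm hrs⟩ : {s : Fin R // s ≠ r})
  exact AlpogeFurman2026_MV_bilinear_of_sep lam δ hδpos hsep x z

/-! ## §3. [AF26] (2.9): the spacing of the frequencies `log n` -/

namespace AlpogeFurman2026.Spectral

/-- **[AF26] (2.9), the spacing of logarithms of integers**: for distinct positive integers
`n ≠ n′`, `|log n − log n′| ≥ 1/(2n)` ("consecutive prime powers satisfy `log(n′/n) ≥ 1/(2n)`, so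
`δ_n⁻¹ ≤ 2n`" — true for any distinct positive integers: if `n < n′` then
`log(n′/n) ≥ 1 − n/n′ ≥ 1/(n+1) ≥ 1/(2n)`; if `n′ < n` then `log(n/n′) ≥ 1 − n′/n ≥ 1/n`).
[cite: AlpogeFurman2026, (2.9) (p. 4)] -/
theorem inv_two_mul_le_abs_log_sub_log {m k : ℕ} (hm : 1 ≤ m) (hk : 1 ≤ k) (hmk : m ≠ k) :
    1 / (2 * (m : ℝ)) ≤ |Real.log m - Real.log k| := by
  have hm0 : (0 : ℝ) < m := by exact_mod_cast hm
  have hk0 : (0 : ℝ) < k := by exact_mod_cast hk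
  rcases lt_or_gt_of_ne hmk with hlt | hgt
  · -- `m < k`: `log k − log m = log (k/m) ≥ 1 − m/k ≥ 1 − m/(m+1) = 1/(m+1) ≥ 1/(2m)`
    have hk' : (m : ℝ) + 1 ≤ k := by exact_mod_cast Nat.succ_le_of_lt hlt
    have h1 : 1 - (m : ℝ) / k ≤ Real.log k - Real.log m := by
      rw [← Real.log_div hk0.ne' hm0.ne']
      have := Real.one_sub_inv_le_log_of_pos (div_pos hk0 hm0)
      rwa [inv_div] at this
    rw [abs_sub_comm, abs_of_nonneg (by
      rw [sub_nonneg]; exact Real.log_le_log hm0 (by linarith))]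
    calc 1 / (2 * (m : ℝ)) ≤ 1 / ((m : ℝ) + 1) := by
          apply one_div_le_one_div_of_le (by linarith)
          have : (1 : ℝ) ≤ m := by exact_mod_cast hm
          linarith
      _ = 1 - (m : ℝ) / (m + 1) := by field_simp; ring
      _ ≤ 1 - (m : ℝ) / k := by
          gcongr
      _ ≤ Real.log k - Real.log m := h1
  · -- `k < m`: `log m − log k = log (m/k) ≥ 1 − k/m = (m − k)/m ≥ 1/m ≥ 1/(2m)`
    have hk' : (k : ℝ) + 1 ≤ m := by exact_mod_cast Nat.succ_le_of_lt hgt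
    have h1 : 1 - (k : ℝ) / m ≤ Real.log m - Real.log k := by
      rw [← Real.log_div hm0.ne' hk0.ne']
      have := Real.one_sub_inv_le_log_of_pos (div_pos hm0 hk0)
      rwa [inv_div] at this
    rw [abs_of_nonneg (by
      rw [sub_nonneg]; exact Real.log_le_log hk0 (by linarith))]
    calc 1 / (2 * (m : ℝ)) ≤ 1 / (m : ℝ) := by
          apply one_div_le_one_div_of_le hm0; linarith
      _ ≤ 1 - (k : ℝ) / m := by
          rw [le_sub_iff_add_le, ← add_div, div_le_one hm0]; linarith
      _ ≤ Real.log m - Real.log k := h1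

end AlpogeFurman2026.Spectral

open AlpogeFurman2026.Spectral in
/-- **[AF26] Lemma 2.2 with (2.9): the Montgomery–Vaughan bilinear form at Dirichlet-polynomial
frequencies.** For distinct positive integers `n_r` (e.g. the prime powers `≤ X`) and complex
`x_r, z_r`, with `λ_r = log n_r` one has `δ_r ≥ 1/(2 n_r)`, hence
`|Σ_{r ≠ s} x_r z̄_s/(log n_r − log n_s)| ≤ 3π (Σ_r n_r|x_r|²)^{1/2} (Σ_r n_r|z_r|²)^{1/2}`
(`(3π/2)·√(2X)·√(2Z) = 3π √X √Z`; the separation function `δ_r := 1/(2n_r)` in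
`AlpogeFurman2026_MV_bilinear_of_sep`). [cite: AlpogeFurman2026, Lemma 2.2 and (2.9) (p. 4)] -/
theorem AlpogeFurman2026_MV_bilinear_log {ι : Type*} [Fintype ι] [DecidableEq ι] (ν : ι → ℕ)
    (hν : ∀ r, 1 ≤ ν r) (hinj : Function.Injective ν) (x z : ι → ℂ) :
    ‖∑ r, ∑ s ∈ univ.erase r,
        x r * conj (z s) / ((Real.log (ν r) - Real.log (ν s) : ℝ) : ℂ)‖ ≤
      3 * π * Real.sqrt (∑ r, (ν r : ℝ) * ‖x r‖ ^ 2) * Real.sqrt (∑ r, (ν r : ℝ) * ‖z r‖ ^ 2) := by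
  set δ : ι → ℝ := fun r ↦ 1 / (2 * (ν r : ℝ)) with hδ_def
  have hδ : ∀ r, 0 < δ r := fun r ↦ by
    have : (0 : ℝ) < ν r := by exact_mod_cast hν r
    simp only [hδ_def]; positivity
  have hsep : ∀ r s, r ≠ s → δ r ≤ |Real.log (ν r) - Real.log (ν s)| := fun r s hrs ↦
    inv_two_mul_le_abs_log_sub_log (hν r) (hν s) fun h ↦ hrs (hinj h)
  have h := AlpogeFurman2026_MV_bilinear_of_sep (fun r ↦ Real.log (ν r)) δ hδ hsep x z
  have hsum : ∀ y : ι → ℂ, ∑ r, ‖y r‖ ^ 2 / δ r = 2 * ∑ r, (ν r : ℝ) * ‖y r‖ ^ 2 := by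
    intro y
    rw [Finset.mul_sum]
    refine Finset.sum_congr rfl fun r _ ↦ ?_
    have : (0 : ℝ) < ν r := by exact_mod_cast hν r
    simp only [hδ_def]
    field_simp
  rw [hsum x, hsum z] at h
  have hX : 0 ≤ ∑ r, (ν r : ℝ) * ‖x r‖ ^ 2 := Finset.sum_nonneg fun r _ ↦ by positivity
  have hZ : 0 ≤ ∑ r, (ν r : ℝ) * ‖z r‖ ^ 2 := Finset.sum_nonneg fun r _ ↦ by positivity
  rw [Real.sqrt_mul' _ hX, Real.sqrt_mul' _ hZ] at h
  have h2 : Real.sqrt 2 * Real.sqrt 2 = 2 := Real.mul_self_sqrt (by norm_num)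
  calc _ ≤ _ := h
    _ = 3 / 2 * π * (Real.sqrt 2 * Real.sqrt 2) * Real.sqrt (∑ r, (ν r : ℝ) * ‖x r‖ ^ 2) *
          Real.sqrt (∑ r, (ν r : ℝ) * ‖z r‖ ^ 2) := by ring
    _ = _ := by rw [h2]; ring

/-! ## §4. [AF26] Lemma 3.3 — Weyl -/

namespace AlpogeFurman2026.Spectral

variable {n : Type*} [Fintype n] [DecidableEq n]

/-- **The eigenvectors above a threshold.** For a Hermitian matrix `B` and a real `θ` there is a
subspace of dimension `#{i : λ_i(B) > θ}` on which `Re xᴴ B x > θ Σ|x_i|²` for `x ≠ 0` (the span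
of the eigenvectors with eigenvalue `> θ`; the case `θ = 0` is the tree's
`AlpogeFurman2026.Inertia.exists_posDef_subspace`). This is the half of Courant–Fischer that the
printed one-line proof "`λ_i(A + E) ≤ λ_i(A) + ‖E‖`" uses. [cite: AlpogeFurman2026, Lemma 3.3, proof (p. 5)] -/
theorem exists_subspace_form_gt {B : Matrix n n ℂ} (hB : B.IsHermitian) (θ : ℝ) :
    ∃ W : Submodule ℂ (n → ℂ),
      finrank ℂ W = (univ.filter fun i ↦ θ < hB.eigenvalues i).card ∧
      ∀ x ∈ W, x ≠ 0 → θ * ∑ i, ‖x i‖ ^ 2 < (star x ⬝ᵥ (B *ᵥ x)).re := by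
  classical
  set S : Finset n := univ.filter fun i ↦ θ < hB.eigenvalues i with hSdef
  set b := hB.eigenvectorBasis with hb
  set T := Matrix.toEuclideanLin B with hT_def
  have hT : T.IsSymmetric := Matrix.isSymmetric_toEuclideanLin_iff.mpr hB
  have hTb : ∀ i, T (b i) = (hB.eigenvalues i : ℂ) • b i := by
    intro i
    simp only [hT_def, Matrix.toLpLin_apply]
    have h := hB.mulVec_eigenvectorBasis i
    rw [← hb] at h
    rw [show (b i).ofLp = ⇑(b i) from rfl, h, RCLike.real_smul_eq_coe_smul (K := ℂ)]
    rfl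
  have hbb : ∀ i j, ⟪b j, b i⟫_ℂ = if j = i then 1 else 0 :=
    fun i j ↦ orthonormal_iff_ite.mp b.orthonormal j i
  -- the combination map `c ↦ Σ_{i ∈ S} c_i b_i`
  let ψ : (S → ℂ) →ₗ[ℂ] EuclideanSpace ℂ n :=
    { toFun := fun c ↦ ∑ i : S, c i • b i
      map_add' := fun c c' ↦ by
        simp only [Pi.add_apply, add_smul, Finset.sum_add_distrib]
      map_smul' := fun a c ↦ by
        simp only [Pi.smul_apply, smul_eq_mul, RingHom.id_apply, Finset.smul_sum, smul_smul] }
  have hψ : ∀ c, ψ c = ∑ i : S, c i • b i := fun c ↦ rfl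
  -- its coordinates in the eigenbasis
  have hcoef : ∀ (c : S → ℂ) (j : n),
      ⟪b j, ψ c⟫_ℂ = if h : j ∈ S then c ⟨j, h⟩ else 0 := by
    intro c j
    rw [hψ, inner_sum]
    simp_rw [inner_smul_right, hbb]
    by_cases hj : j ∈ S
    · rw [dif_pos hj, Fintype.sum_eq_single ⟨j, hj⟩]
      · simp
      · intro i hi
        have : (j : n) ≠ i := fun h ↦ hi (Subtype.ext h.symm)
        simp [this]
    · rw [dif_neg hj]
      refine Finset.sum_eq_zero fun i _ ↦ ?_
      have : (j : n) ≠ i := fun h ↦ hj (h ▸ i.2)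
      simp [this]
  have hinj : Function.Injective ψ := by
    rw [← LinearMap.ker_eq_bot, LinearMap.ker_eq_bot']
    intro c hc
    funext j
    have := hcoef c j
    rw [hc, inner_zero_right, dif_pos j.2] at this
    exact this.symm
  -- transport to `n → ℂ`
  let e : EuclideanSpace ℂ n ≃ₗ[ℂ] (n → ℂ) := WithLp.linearEquiv 2 ℂ (n → ℂ)
  refine ⟨(LinearMap.range ψ).map (e : EuclideanSpace ℂ n →ₗ[ℂ] (n → ℂ)), ?_, ?_⟩
  · rw [LinearEquiv.finrank_map_eq, LinearMap.finrank_range_of_inj hinj,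
      Module.finrank_fintype_fun_eq_card, Fintype.card_coe]
  · rintro x ⟨X, ⟨c, rfl⟩, rfl⟩ hx
    have hc : c ≠ 0 := by
      rintro rfl
      exact hx (by simp)
    obtain ⟨j, hj⟩ : ∃ j, c j ≠ 0 := by
      by_contra h
      push Not at h
      exact hc (funext h)
    -- the form and the norm in eigen-coordinates
    have hx_eq : (e (ψ c) : n → ℂ) = (ψ c).ofLp := rfl
    have hform : star (e (ψ c)) ⬝ᵥ (B *ᵥ e (ψ c)) = ⟪ψ c, T (ψ c)⟫_ℂ := by
      rw [hx_eq]
      exact (inner_toEuclideanLin_eq_dotProduct B _ _).symm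
    have hrepr : ∀ i, ⟪b i, T (ψ c)⟫_ℂ = (hB.eigenvalues i : ℂ) * ⟪b i, ψ c⟫_ℂ := by
      intro i
      rw [← hT (b i) (ψ c), hTb i, inner_smul_left, Complex.conj_ofReal]
    have hform2 : (⟪ψ c, T (ψ c)⟫_ℂ).re = ∑ i, hB.eigenvalues i * ‖⟪b i, ψ c⟫_ℂ‖ ^ 2 := by
      rw [← b.sum_inner_mul_inner (ψ c) (T (ψ c)), Complex.re_sum]
      refine Finset.sum_congr rfl fun i _ ↦ ?_
      rw [hrepr i, ← inner_conj_symm (ψ c) (b i)]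
      have : conj ⟪b i, ψ c⟫_ℂ * ((hB.eigenvalues i : ℂ) * ⟪b i, ψ c⟫_ℂ) =
          ((hB.eigenvalues i * ‖⟪b i, ψ c⟫_ℂ‖ ^ 2 : ℝ) : ℂ) := by
        push_cast
        rw [mul_left_comm, Complex.conj_mul']
      rw [this, Complex.ofReal_re]
    have hnorm : ∑ i, ‖(e (ψ c) : n → ℂ) i‖ ^ 2 = ∑ i, ‖⟪b i, ψ c⟫_ℂ‖ ^ 2 := by
      rw [hx_eq, ← EuclideanSpace.norm_sq_eq, ← b.repr.norm_map (ψ c), EuclideanSpace.norm_sq_eq]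
      simp only [OrthonormalBasis.repr_apply_apply]
    change θ * ∑ i, ‖(e (ψ c) : n → ℂ) i‖ ^ 2 < (star (e (ψ c)) ⬝ᵥ (B *ᵥ e (ψ c))).re
    rw [hform, hform2, hnorm, Finset.mul_sum, ← sub_pos, ← Finset.sum_sub_distrib]
    simp_rw [← sub_mul]
    -- termwise: zero off `S`, non-negative on `S`, positive at `j`
    refine Finset.sum_pos' (fun i _ ↦ ?_) ⟨j.1, Finset.mem_univ _, ?_⟩
    · by_cases hi : i ∈ S
      · exact mul_nonneg (sub_nonneg.2 (le_of_lt (by simpa [hSdef] using hi))) (by positivity)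
      · rw [hcoef c i, dif_neg hi]; simp
    · have hjS : θ < hB.eigenvalues j.1 := by
        have h : (j.1 : n) ∈ S := j.2
        exact (Finset.mem_filter.1 h).2
      refine mul_pos (sub_pos.2 hjS) (pow_pos (norm_pos_iff.2 ?_) 2)
      rw [hcoef c j.1, dif_pos j.2]
      exact hj

end AlpogeFurman2026.Spectral

open AlpogeFurman2026.Spectral AlpogeFurman2026.Inertia in
/-- **[AF26] Lemma 3.3 (Weyl), form version.** If `A` and `A + E` are Hermitian and
`Re xᴴ E x ≤ θ Σ|x_i|²` for all `x` (for Hermitian `E` this is `λ_max(E) ≤ θ`, implied by `‖E‖ ≤ θ`),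
then `n₊(A) ≥ #{i : λ_i(A + E) > θ}`. Proof: on the span `W` of the eigenvectors of `A + E` with
eigenvalue `> θ` (`exists_subspace_form_gt`), `xᴴ A x = xᴴ (A+E) x − xᴴ E x > θ‖x‖² − θ‖x‖² = 0`,
so `dim W ≤ n₊(A)` by Sylvester (`finrank_le_posEigenvalueCount`) — the printed
"`λ_i(A + E) ≤ λ_i(A) + ‖E‖` (Courant–Fischer)". [cite: AlpogeFurman2026, Lemma 3.3 (p. 5)] -/
theorem AlpogeFurman2026_weyl {n : Type*} [Fintype n] [DecidableEq n] {A E : Matrix n n ℂ}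
    (hA : A.IsHermitian) (hAE : (A + E).IsHermitian) {θ : ℝ}
    (hE : ∀ x : n → ℂ, (star x ⬝ᵥ (E *ᵥ x)).re ≤ θ * ∑ i, ‖x i‖ ^ 2) :
    (univ.filter fun i ↦ θ < hAE.eigenvalues i).card ≤ posEigenvalueCount hA := by
  obtain ⟨W, hW, hgt⟩ := exists_subspace_form_gt hAE θ
  rw [← hW]
  refine finrank_le_posEigenvalueCount hA W fun x hx hx0 ↦ ?_
  have h1 := hgt x hx hx0
  have h2 := hE x
  have hsplit : star x ⬝ᵥ (A *ᵥ x) = star x ⬝ᵥ ((A + E) *ᵥ x) - star x ⬝ᵥ (E *ᵥ x) := by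
    rw [Matrix.add_mulVec, dotProduct_add]; ring
  rw [hsplit, Complex.sub_re]
  linarith

open AlpogeFurman2026.Spectral in
/-- `‖E‖ ≤ θ` in the `L²`-operator norm gives `Re xᴴ E x ≤ |xᴴ E x| ≤ ‖x‖ ‖Ex‖ ≤ θ ‖x‖²`
(Cauchy–Schwarz; no Hermitian hypothesis needed for this direction).
[cite: AlpogeFurman2026, Lemma 3.3, proof (p. 5)] -/
theorem AlpogeFurman2026.Spectral.re_form_le_of_opNorm_le {n : Type*} [Fintype n] [DecidableEq n]
    {E : Matrix n n ℂ} {θ : ℝ} (hθ : ‖E‖ ≤ θ) (x : n → ℂ) :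
    (star x ⬝ᵥ (E *ᵥ x)).re ≤ θ * ∑ i, ‖x i‖ ^ 2 := by
  set X : EuclideanSpace ℂ n := WithLp.toLp 2 x with hX
  have hEX : ‖(WithLp.toLp 2 (E *ᵥ x) : EuclideanSpace ℂ n)‖ ≤ ‖E‖ * ‖X‖ :=
    Matrix.l2_opNorm_mulVec E X
  have hinner : star x ⬝ᵥ (E *ᵥ x) = ⟪X, (WithLp.toLp 2 (E *ᵥ x) : EuclideanSpace ℂ n)⟫_ℂ := by
    rw [← inner_toEuclideanLin_eq_dotProduct E x x]
    rfl
  have hnorm : ‖X‖ ^ 2 = ∑ i, ‖x i‖ ^ 2 := by rw [EuclideanSpace.norm_sq_eq]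
  calc (star x ⬝ᵥ (E *ᵥ x)).re ≤ ‖star x ⬝ᵥ (E *ᵥ x)‖ := Complex.re_le_norm _
    _ = ‖⟪X, (WithLp.toLp 2 (E *ᵥ x) : EuclideanSpace ℂ n)⟫_ℂ‖ := by rw [hinner]
    _ ≤ ‖X‖ * ‖(WithLp.toLp 2 (E *ᵥ x) : EuclideanSpace ℂ n)‖ := norm_inner_le_norm _ _
    _ ≤ ‖X‖ * (θ * ‖X‖) :=
        mul_le_mul_of_nonneg_left (hEX.trans (mul_le_mul_of_nonneg_right hθ (norm_nonneg _)))
          (norm_nonneg _)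
    _ = θ * ∑ i, ‖x i‖ ^ 2 := by rw [← hnorm]; ring

open AlpogeFurman2026.Spectral in
/-- **[AF26] Lemma 3.3 (Weyl), AS PRINTED.** "If `A, E` are Hermitian with `‖E‖ ≤ θ`, then
`n₊(A) ≥ #{i : λ_i(A + E) > θ}`." Here `‖E‖` is the operator norm on `ℂⁿ` (Mathlib's
`L²`-operator norm on `Matrix n n ℂ`, scope `Matrix.Norms.L2Operator`), `λ_i(A + E)` are Mathlib's
`IsHermitian.eigenvalues` of `A + E` (any fixed proof `hAE`; `E` Hermitian is implied by `hA` and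
`hAE`), `n₊ = posEigenvalueCount`. [cite: AlpogeFurman2026, Lemma 3.3 (p. 5)] -/
theorem AlpogeFurman2026_weyl_opNorm {n : Type*} [Fintype n] [DecidableEq n] {A E : Matrix n n ℂ}
    (hA : A.IsHermitian) (hAE : (A + E).IsHermitian) {θ : ℝ} (hθ : ‖E‖ ≤ θ) :
    (univ.filter fun i ↦ θ < hAE.eigenvalues i).card ≤ posEigenvalueCount hA :=
  AlpogeFurman2026_weyl hA hAE fun x ↦ re_form_le_of_opNorm_le hθ x

end Literature.NumberTheory.LFunctions

end
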